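import Summits.ResolutionOfSingularities.ResolutionOfSingularities.Theses.UniversalCells
import Summits.ResolutionOfSingularities.ResolutionOfSingularities.Theorems.UniversalCellsDefs
import Summits.ResolutionOfSingularities.ResolutionOfSingularities.Theorems.UniversalCellsUniversalityAffinePresentation
import Summits.ResolutionOfSingularities.ResolutionOfSingularities.Theorems.UniversalCellsUniversalityFlattening
import Summits.ResolutionOfSingularities.ResolutionOfSingularities.Theorems.UniversalCellsUniversalityStratumReindex
import Summits.ResolutionOfSingularities.ResolutionOfSingularities.Theorems.UniversalCellsUniversalityTorusSplitting
import Summits.ResolutionOfSingularities.ResolutionOfSingularities.Theorems.UniversalCellsUniversalityNormalizedEncoding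
import Summits.ResolutionOfSingularities.ResolutionOfSingularities.Theorems.UniversalCellsUniversalityChartGlobalisation
import HarnessLib

/-!
# Crux `Universality` (stmt-ResolutionOfSingularities-15234) — the assembly (line `birth`)

`theorem Universality_proof : UniversalCells.Universality` — MNËV–LAFFORGUE–LEE–VAKIL UNIVERSALITY in
the route's matrix form over the prime field: for `Y` integral, separated, of finite type over
`Spec 𝔽_p` and `y ∈ Y` there are `m, Γ₊, Γ₀, s`, an integral scheme `W`, an open immersion
`j : W ⟶ 𝔸ˢ_Y`, an open immersion `i` of `W` into the partial matroid stratum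
`P(p, m, Γ₊, Γ₀) = Spec ((𝔽_p[a_ij : 3 × m] ⧸ ⟨Γ₀-minors of [I₃ | A]⟩)[1 / ∏_{Γ₊} minors])`, and `w ∈ W`
over `y`.

The proof is the composition of the six registered stubs of line `birth` (all landed under
`Theorems/UniversalCellsUniversality*.lean`), exactly as in the lead's skeleton
`Cruxes/Universality/Lines/birth.lean`:

* `elementaryChart` (`stub_affinePresentation` ∘ `stub_flattening`): an affine open `U ∋ y` with
  `Γ(Y, U) ≃+* ElemRing p N Eadd Emul Eone` (Lee–Vakil 2012 §2 (a), eq. (e:fg));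
* `matroidEncoding` (`stub_stratumReindex` ∘ `stub_torusSplitting` ∘ `stub_normalizedEncoding` + the
  glue `StratumReindex.awayCongr` (landed with the reindexing stub) / `torusRingCongrRight` / `torusRingCongrLeft` / `prod_X_not_mem_map_C`): for every
  prime `𝔮` of the elementary ring `B`, chart data `m, Γ₊, Γ₀, s`, `g := ∏ t_i ∉ 𝔮B[t]`, `h := 1` and
  `B[t][1/g] ≃+* S(p, m, Γ₊, Γ₀)[1/h]` — the von Staudt encoding on PARTIAL strata (impose only the
  wanted minors) followed by Gelfand–MacPherson torus splitting and column reindexing;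
* `stub_chartGlobalisation`: the scheme-theoretic globalisation at `y`.

No definition is declared here. Sources: LeeVakil2012 (arXiv:1202.3934) Thm 1.1, §2–3; Lafforgue2003
Thm I.11/I.14; Hu2021 (arXiv:2109.02968) Thms 9.3–9.4; Mnev1988.
-/

noncomputable section

-- single-problem summit: the doubled namespace component `ResolutionOfSingularities` is forced
set_option linter.dupNamespace false

open CategoryTheory AlgebraicGeometry
open Summit.ResolutionOfSingularities.ResolutionOfSingularities.Theses.UniversalCells (Universality)

namespace Summit.ResolutionOfSingularities.ResolutionOfSingularities.Theorems.UniversalCells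

/-! ## Small glue lemmas (functoriality of `Localization.Away` is `StratumReindex.awayCongr`) -/

/-- `TorusRing T` is functorial in the coefficient ring. [folklore] -/
lemma torusRingCongrRight (T : Type) [Fintype T] {R R' : Type} [CommRing R] [CommRing R']
    (e : R ≃+* R') : Nonempty (TorusRing T R ≃+* TorusRing T R') :=
  StratumReindex.awayCongr (MvPolynomial.mapEquiv T e : MvPolynomial T R ≃+* MvPolynomial T R') _ _
    (by rw [map_prod]; simp [MvPolynomial.mapEquiv_apply])

/-- `TorusRing T R` only depends on `T` up to bijection. [folklore] -/
lemma torusRingCongrLeft {T T' : Type} [Fintype T] [Fintype T'] (R : Type) [CommRing R]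
    (eT : T ≃ T') : Nonempty (TorusRing T R ≃+* TorusRing T' R) :=
  StratumReindex.awayCongr ((MvPolynomial.renameEquiv R eT : MvPolynomial T R ≃ₐ[R] MvPolynomial T' R) :
      MvPolynomial T R ≃+* MvPolynomial T' R)
    _ _ (by
      rw [map_prod]
      simp only [AlgEquiv.coe_ringEquiv, MvPolynomial.renameEquiv_apply, MvPolynomial.rename_X]
      exact Fintype.prod_equiv eT _ _ (fun _ => rfl))

/-- A product of variables lies outside `𝔮 · B[t]` for a prime `𝔮`. [folklore] -/
lemma prod_X_not_mem_map_C {B : Type} [CommRing B] (σ : Type) [Fintype σ] (𝔮 : Ideal B)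
    [𝔮.IsPrime] :
    (∏ t : σ, (MvPolynomial.X t : MvPolynomial σ B)) ∉
      Ideal.map (MvPolynomial.C : B →+* MvPolynomial σ B) 𝔮 := by
  intro hg
  have hker : (∏ t : σ, (MvPolynomial.X t : MvPolynomial σ B)) ∈
      RingHom.ker (MvPolynomial.map (σ := σ) (Ideal.Quotient.mk 𝔮)) := by
    rwa [MvPolynomial.ker_map, Ideal.mk_ker]
  rw [RingHom.mem_ker, map_prod] at hker
  simp only [MvPolynomial.map_X] at hker
  exact (Finset.prod_ne_zero_iff.mpr fun t _ => MvPolynomial.X_ne_zero (R := B ⧸ 𝔮) t) hker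

/-! ## The two intermediate moves of the birth skeleton, now theorems -/

/-- VON STAUDT–MNËV ENCODING, RING FORM (the birth skeleton's load-bearing statement
`Sig.stub_matroidEncoding`, proved): for a prime `p`, an elementary ring `B = ElemRing p N E` and a
prime `𝔮 ⊂ B` there are `m, Γ₊, Γ₀, s`, `g ∈ B[t_1..t_s]` outside `𝔮B[t]` and `h ∈ S(p, m, Γ₊, Γ₀)`
with `B[t][1/g] ≃+* S[1/h]`. Proof: `S(Fin m) ≃ S(Unit ⊕ Kol N)` (`stub_stratumReindex`)
`≃ NormRing[λ^±, μ^±]` (`stub_torusSplitting`) `≃ B[λ^±, μ^±]` (`stub_normalizedEncoding`)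
`≃ B[t_1..t_s][1/∏ t]`, with `g := ∏ t` and `h := 1`. [cite: LeeVakil2012, Thm. 1.1; Lafforgue2003,
Thm. I.14; Hu2021, Thm. 9.4] -/
theorem matroidEncoding (p : ℕ) (_hp : p.Prime) (N : ℕ)
    (Eadd Emul : Finset (Fin N × Fin N × Fin N)) (Eone : Finset (Fin N))
    (𝔮 : Ideal (ElemRing p N Eadd Emul Eone)) (h𝔮 : 𝔮.IsPrime) :
    ∃ (m : ℕ) (Γp : Finset (Fin 3 → Fin 3 ⊕ Fin m)) (Γ0 : Set (Fin 3 → Fin 3 ⊕ Fin m)) (s : ℕ)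
      (g : MvPolynomial (Fin s) (ElemRing p N Eadd Emul Eone)) (h : StratumRing p m Γp Γ0),
      g ∉ Ideal.map (MvPolynomial.C : ElemRing p N Eadd Emul Eone →+* _) 𝔮 ∧
        Nonempty (Localization.Away g ≃+* Localization.Away h) := by
  classical
  let m : ℕ := Fintype.card (Unit ⊕ Kol N)
  let e : Unit ⊕ Kol N ≃ Fin m := Fintype.equivFin _
  let s : ℕ := Fintype.card (Fin 3 ⊕ Kol N)
  let eT : Fin 3 ⊕ Kol N ≃ Fin s := Fintype.equivFin _
  obtain ⟨e1⟩ := stub_stratumReindex p (Unit ⊕ Kol N) m e (designatedSels (Kol N) (dRow N))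
    (config N Eadd Emul Eone)
  obtain ⟨e2⟩ := stub_torusSplitting p (Kol N) (dRow N) (config N Eadd Emul Eone)
  obtain ⟨e3⟩ := stub_normalizedEncoding p N Eadd Emul Eone
  obtain ⟨e4⟩ := torusRingCongrRight (Fin 3 ⊕ Kol N) e3
  obtain ⟨e5⟩ := torusRingCongrLeft (ElemRing p N Eadd Emul Eone) eT
  refine ⟨m, (designatedSels (Kol N) (dRow N)).image fun u => Sum.map id e ∘ u,
    (fun u => Sum.map id e ∘ u) '' config N Eadd Emul Eone, s,
    ∏ t : Fin s, MvPolynomial.X t, 1, prod_X_not_mem_map_C (Fin s) 𝔮, ⟨?_⟩⟩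
  have e6 := (IsLocalization.atOne
    (R := StratumRing p m ((designatedSels (Kol N) (dRow N)).image fun u => Sum.map id e ∘ u)
      ((fun u => Sum.map id e ∘ u) '' config N Eadd Emul Eone))
    (S := Localization.Away (1 : StratumRing p m
      ((designatedSels (Kol N) (dRow N)).image fun u => Sum.map id e ∘ u)
      ((fun u => Sum.map id e ∘ u) '' config N Eadd Emul Eone)))).toRingEquiv
  exact e5.symm.trans (e4.symm.trans (e2.symm.trans (e1.trans e6)))

/-- ELEMENTARY AFFINE CHARTS (the birth skeleton's `Sig.stub_elementaryChart`, proved): around any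
point of a scheme locally of finite type over `Spec (ZMod p)` there is an affine open whose ring has an
elementary presentation. [cite: LeeVakil2012, §2 Strategy (a), eq. (e:fg)] -/
theorem elementaryChart (p : ℕ) (hp : p.Prime) (Y : Scheme.{0}) (f : Y ⟶ Spec (.of (ZMod p)))
    (hf : LocallyOfFiniteType f) (y : Y) :
    ∃ U : Y.Opens, IsAffineOpen U ∧ y ∈ U ∧
      ∃ (N : ℕ) (Eadd Emul : Finset (Fin N × Fin N × Fin N)) (Eone : Finset (Fin N)),
        Nonempty (Γ(Y, U) ≃+* ElemRing p N Eadd Emul Eone) := by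
  obtain ⟨U, hU, hy, n, S, ⟨e₁⟩⟩ := stub_affinePresentation p hp Y f hf y
  obtain ⟨N, Eadd, Emul, Eone, ⟨e₂⟩⟩ := stub_flattening p hp n S
  exact ⟨U, hU, hy, N, Eadd, Emul, Eone, ⟨e₁.trans e₂⟩⟩

/-! ## The crux -/

/-- **MNËV–LAFFORGUE–LEE–VAKIL UNIVERSALITY, matrix form over the prime field** — the crux
`UniversalCells.Universality` (stmt-ResolutionOfSingularities-15234), PROVED: at `y ∈ Y` take an
elementary affine chart `U ∋ y`, `e : Γ(Y, U) ≃+* B` (`elementaryChart`); push the prime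
`𝔭_y = hU.primeIdealOf ⟨y, hy⟩` through `e` (`Ideal.map_isPrime_of_equiv`); encode
(`matroidEncoding`); globalise (`stub_chartGlobalisation`). The stratum ring `StratumRing p m Γp Γ0`
is the crux's `let`-bound ring verbatim, so the anonymous constructor closes the crux by `rfl`.
[cite: LeeVakil2012, Thm. 1.1, §2; Lafforgue2003, Thm. I.14; Mnev1988] -/
theorem Universality_proof : Universality := by
  intro p hp Y f _hsep hlft _hqc hint y
  obtain ⟨U, hU, hy, N, Eadd, Emul, Eone, ⟨e⟩⟩ := elementaryChart p hp Y f hlft y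
  have hprime : (Ideal.map e (hU.primeIdealOf ⟨y, hy⟩).asIdeal).IsPrime :=
    Ideal.map_isPrime_of_equiv e
  obtain ⟨m, Γp, Γ0, s, g, h, hg, ⟨echart⟩⟩ :=
    matroidEncoding p hp N Eadd Emul Eone (Ideal.map e (hU.primeIdealOf ⟨y, hy⟩).asIdeal) hprime
  obtain ⟨W, j, w, i, hj, hi, hW, hwy⟩ := stub_chartGlobalisation p Y hint y U hU hy
    (ElemRing p N Eadd Emul Eone) e m Γp Γ0 s g h hg echart
  exact ⟨m, Γp, Γ0, s, W, j, w, i, hj, hi, hW, hwy⟩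

end Summit.ResolutionOfSingularities.ResolutionOfSingularities.Theorems.UniversalCells

end
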